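import Summits.Ventures.LatticeQCDFlow.Scaling.SimulatedTemperingAlgorithm

/-!
HONEST FRAMING: exact (Metropolis-corrected) sampling algorithms for lattice gauge theory; figures
of merit are autocorrelation/cost numbers at stated couplings and volumes; no continuum-physics
claim.

# SimulatedTemperingExactLevelLaw — THE LEVEL OF THE SIMULATED-TEMPERING SAMPLER PERFORMS EXACTLY A LAZY RANDOM
# WALK: `ρ_lev(1) = 1 − 6r̄/(K(K+2))` FOR EVERY NEAREST-NEIGHBOUR LEVEL PROCESS WITH EQUALLY VISITED LEVELS
# (`r̄` THE STATIONARY MOVE RATE), `= 1 − 3ā_K/(K(K+2))` FOR THE CONSTRUCTED SAMPLER, AND THE TWO-SIDED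
# LADDER LAW `6e^{−(Δ√M+MΔ²)} ≤ (K+1)(K+2)(1 − ρ_lev(1)) ≤ 6e^{−mΔ²/8}`, `Δ = (b−a)/K` (lean-2 GEN-14, ours)

Venture-side (OURS).  Cell `lqcd-flow` (pub-lqcd), unit `pub-lqcd-lean-2-g14`, 2026-08-24.  GEN-13's level law
is a FLOOR (`ρ_lev(1) ≥ 1 − 6ā_K/(K(K+2))`) for every kernel with (i)–(iii).  For the sampler CONSTRUCTED in
GEN-14 (`Scaling/SimulatedTemperingAlgorithm`: exact-weight Metropolis level move `L = stLevelKernel`, any exact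
within-level sweep `W = stWithinLevel M`, deterministic scan `W ∘ₖ L` / `L ∘ₖ W` or random scan `t·L + (1−t)·W`)
the law is an IDENTITY.  Mechanism: GEN-13's Dirichlet identity `∫∫(f y − f x)² κ(x,dy)π(dx) = 2(∫f² − autocov₁)`
with `f` the level; under nearest-neighbour moves `(Δlevel)² = 1[level moves]` almost surely, so
`Var_π(lev)·(1 − ρ_lev(1)) = ½·r̄`, `r̄ = ∫ κ(x){lev ≠ lev x} dπ` the stationary move rate — for ANY such kernel;
for the constructed sampler `r̄ = ∫ (u + d) dπ = ½ā_K` (`st_moveRate_eq`, the equality behind GEN-13's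
`st_moveRate_le`), `ā_K = (2/(K+1))·Σ_{k<K} ∫ min(p_{β_k}, p_{β_{k+1}}) dμ`.

## What is proved

* §1 (general `E`, Markov `κ` with invariant probability `π`, measurable level `lev ≤ K` moved by at most one
  rung): `measurable_levelMoveProb`; `integral_sq_sub_level_eq` (`∫(lev y − lev x)² κ(x,dy) = κ(x){lev ≠ lev x}`);
  **`level_sq_integral_sub_autocov_eq`** (`∫lev² dπ − autocov₁ = ½r̄`); for equally visited levels and `K ≥ 1`
  **`level_lagOneAutocorr_eq`**: `ρ_lev(1) = 1 − 6r̄/(K(K+2))`.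
* §2 (`μ` probability, `X` bounded measurable): `stLevelKernel_real_moves_eq` (`L(z){lev ≠ lev z} = u(z) + d(z)`),
  **`st_moveRate_eq`** (`∫ (u+d) dπ = ½ā_K`); **`stLevelKernel_level_lagOneAutocorr_eq`**,
  **`stScan_level_lagOneAutocorr_eq`** (`W ∘ₖ L`), **`stScan_level_lagOneAutocorr_eq_before`** (`L ∘ₖ W`):
  `ρ_lev(1) = 1 − 3ā_K/(K(K+2))`; **`stMix_level_lagOneAutocorr_eq`**: `ρ_lev(1) = 1 − 3t·ā_K/(K(K+2))`.
* §3 uniform ladder `β_k = a + kΔ`, `Δ = (b−a)/K`, `a < b`, with a variance FLOOR AND CEILING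
  `m ≤ Var_{μ_u}(X) ≤ M` on `[a,b]` (GEN-11's `overlap_le_exp_neg_floor` / `overlap_ge_exp_neg_ceiling`):
  **`stScan_one_sub_lagOneAutocorr_twoSided`** —
  `6·e^{−(Δ√M + MΔ²)}/((K+1)(K+2)) ≤ 1 − ρ_lev(1) ≤ 6·e^{−mΔ²/8}/((K+1)(K+2))`.

Reading (no numerics implied): the coupling index of the textbook sampler is EXACTLY diffusive — with
`K ≍ (b−a)√M` levels it decorrelates at rate `Θ(1/K²) = Θ(1/(M(b−a)²))` per step and no faster, and with fewer
levels exponentially slower; GEN-13's floor is attained up to the factor `2` of the proposal probability.  NOT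
CLAIMED: higher lags / `τ_int` identities (only lag one is an identity); non-uniform ladders in §3; anything
measured.  Literature grade (cell rule): KNOWN MECHANISM (random-walk picture of tempering, Katzgraber–Trebst–
Huse–Troyer 2006), NEW TYPING (an identity at the kernel level); nothing cited as a fact; no new bib keys.
-/

noncomputable section

open MeasureTheory ProbabilityTheory Set Filter Finset
open Summit.Ventures.LatticeQCDFlow.Scoring
open scoped ENNReal

namespace Summit.Ventures.LatticeQCDFlow.Scaling

/-! ## §1 The exact Dirichlet identity for a nearest-neighbour level -/

section General

variable {E : Type*} [MeasurableSpace E] {κ : Kernel E E} [IsMarkovKernel κ] {π : Measure E}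
  [IsProbabilityMeasure π] {lev : E → ℕ} {K : ℕ}

omit [IsProbabilityMeasure π] in
/-- The probability that one step moves the level, `x ↦ κ(x){lev ≠ lev x}`, is measurable. [folklore] -/
theorem measurable_levelMoveProb (hlev : Measurable lev) : Measurable fun x => (κ x).real {y | lev y ≠ lev x} := by
  have hf1 : Measurable fun p : E × E => ((lev p.1 : ℕ) : ℝ) := measurable_from_nat.comp (hlev.comp measurable_fst)
  have hf2 : Measurable fun p : E × E => ((lev p.2 : ℕ) : ℝ) := measurable_from_nat.comp (hlev.comp measurable_snd)
  have hT : MeasurableSet {p : E × E | lev p.2 ≠ lev p.1} := by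
    have e : {p : E × E | lev p.2 ≠ lev p.1} = {p : E × E | ((lev p.2 : ℕ) : ℝ) = ((lev p.1 : ℕ) : ℝ)}ᶜ := by
      ext p; simp
    rw [e]; exact (measurableSet_eq_fun hf2 hf1).compl
  exact (Kernel.measurable_kernel_prodMk_left hT).ennreal_toReal

omit [IsMarkovKernel κ] [IsProbabilityMeasure π] in
/-- **Under nearest-neighbour moves the squared level increment IS the move indicator**:
`∫ (lev y − lev x)² κ(x,dy) = κ(x){lev ≠ lev x}`. [ours] -/
theorem integral_sq_sub_level_eq (hlev : Measurable lev)
    (hnn : ∀ x, ∀ᵐ y ∂(κ x), |((lev y : ℕ) : ℝ) - lev x| ≤ 1) (x : E) :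
    ∫ y, (((lev y : ℕ) : ℝ) - lev x) ^ 2 ∂(κ x) = (κ x).real {y | lev y ≠ lev x} := by
  have hS : MeasurableSet {y | lev y ≠ lev x} := (hlev (measurableSet_singleton (lev x))).compl
  rw [← integral_indicator_one hS]
  refine integral_congr_ae ?_
  filter_upwards [hnn x] with y hy
  by_cases h : lev y = lev x
  · have : y ∉ {y | lev y ≠ lev x} := by simp [h]
    rw [Set.indicator_of_notMem this, h, sub_self]
    simp
  · have hmem : y ∈ {y | lev y ≠ lev x} := h
    rw [Set.indicator_of_mem hmem, Pi.one_apply]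
    -- `|lev y − lev x| ≥ 1` for distinct naturals, so `= 1`
    have hge : 1 ≤ |((lev y : ℕ) : ℝ) - lev x| := by
      rcases Nat.lt_or_gt_of_ne h with hlt | hgt
      · have : ((lev y : ℕ) : ℝ) + 1 ≤ lev x := by exact_mod_cast hlt
        rw [abs_of_neg (by linarith)]; linarith
      · have : ((lev x : ℕ) : ℝ) + 1 ≤ lev y := by exact_mod_cast hgt
        rw [abs_of_pos (by linarith)]; linarith
    have heq : |((lev y : ℕ) : ℝ) - lev x| = 1 := le_antisymm hy hge
    rw [← sq_abs, heq, one_pow]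

/-- **THE EXACT DIRICHLET IDENTITY FOR A NEAREST-NEIGHBOUR LEVEL**: `κ` Markov with invariant probability `π`,
`lev ≤ K` measurable, moved by at most one rung per step:
`∫ lev² dπ − autocov κ π lev 1 = ½·∫ κ(x){lev ≠ lev x} dπ(x)`. [ours] -/
theorem level_sq_integral_sub_autocov_eq (hπ : Kernel.Invariant κ π) (hlev : Measurable lev)
    (hK : ∀ x, lev x ≤ K) (hnn : ∀ x, ∀ᵐ y ∂(κ x), |((lev y : ℕ) : ℝ) - lev x| ≤ 1) :
    ∫ x, ((lev x : ℕ) : ℝ) ^ 2 ∂π - autocov κ π (fun x => ((lev x : ℕ) : ℝ)) 1 =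
      1 / 2 * ∫ x, (κ x).real {y | lev y ≠ lev x} ∂π := by
  have hfm : Measurable fun x => ((lev x : ℕ) : ℝ) := measurable_from_nat.comp hlev
  have hD := dirichlet_identity hπ hfm (abs_level_le hK)
  rw [integral_congr_ae (ae_of_all _ (integral_sq_sub_level_eq (κ := κ) hlev hnn))] at hD
  linarith

/-- **THE EXACT LEVEL LAW**: for `K ≥ 1` equally visited levels `0, …, K` (`π{lev = k} = 1/(K+1)`),
nearest-neighbour moves and `π` invariant:
`ρ_lev(1) = (autocov₁ − (K/2)²)/(K(K+2)/12) = 1 − 6r̄/(K(K+2))`, `r̄ = ∫ κ(x){lev ≠ lev x} dπ`. [ours] -/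
theorem level_lagOneAutocorr_eq (hπ : Kernel.Invariant κ π) (hlev : Measurable lev) (hK : ∀ x, lev x ≤ K)
    (hK1 : 1 ≤ K) (hunif : ∀ k, k ≤ K → π.real {x | lev x = k} = 1 / (K + 1))
    (hnn : ∀ x, ∀ᵐ y ∂(κ x), |((lev y : ℕ) : ℝ) - lev x| ≤ 1) :
    (autocov κ π (fun x => ((lev x : ℕ) : ℝ)) 1 - ((K : ℝ) / 2) ^ 2) / (K * (K + 2) / 12) =
      1 - 6 * (∫ x, (κ x).real {y | lev y ≠ lev x} ∂π) / (K * (K + 2)) := by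
  have h := level_sq_integral_sub_autocov_eq hπ hlev hK hnn
  have hv := level_variance_eq (π := π) hlev hK hunif
  rw [level_mean_eq hlev hK hunif] at hv
  have hKpos : (0 : ℝ) < K * (K + 2) := by
    have : (1 : ℝ) ≤ K := by exact_mod_cast hK1
    positivity
  field_simp
  linarith

end General

/-! ## §2 The constructed sampler: `r̄ = ½ā_K`, hence `ρ_lev(1) = 1 − 3ā_K/(K(K+2))` -/

section Sampler

variable {Ω : Type*} [MeasurableSpace Ω] {X : Ω → ℝ} {μ : Measure Ω} {β : ℕ → ℝ} {K : ℕ}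

/-- **The level kernel moves the level with probability exactly `u + d`.** [ours] -/
theorem stLevelKernel_real_moves_eq (hXm : Measurable X) (z : Fin (K + 1) × Ω) :
    (stLevelKernel hXm μ β K z).real {y | ((y.1 : Fin (K + 1)) : ℕ) ≠ ((z.1 : Fin (K + 1)) : ℕ)} =
      stUpProb X μ β K z + stDownProb X μ β K z := by
  set S : Set (Fin (K + 1) × Ω) := {y | ((y.1 : Fin (K + 1)) : ℕ) ≠ ((z.1 : Fin (K + 1)) : ℕ)} with hS_def
  have e : S = (fun y : Fin (K + 1) × Ω => ((y.1 : Fin (K + 1)) : ℕ)) ⁻¹' {n : ℕ | n ≠ ((z.1 : Fin (K + 1)) : ℕ)} := by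
    ext y; simp [hS_def]
  have hS : MeasurableSet S := by rw [e]; exact measurable_stLevel MeasurableSet.of_discrete
  rw [measureReal_def, stLevelKernel_apply' hXm z hS]
  have h3 : z ∉ S := by simp [hS_def]
  rw [Set.indicator_of_notMem h3, mul_zero, add_zero]
  -- the up term equals `u` (either the successor differs from `k`, or `u = 0` at the top rung)
  have hup : ENNReal.ofReal (stUpProb X μ β K z) * S.indicator 1 ((levUp K z.1, z.2) : Fin (K + 1) × Ω) =
      ENNReal.ofReal (stUpProb X μ β K z) := by
    by_cases hk : ((z.1 : Fin (K + 1)) : ℕ) < K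
    · have hmem : ((levUp K z.1, z.2) : Fin (K + 1) × Ω) ∈ S := by
        rw [hS_def, Set.mem_setOf_eq, levUp_val_of_lt hk]; omega
      rw [Set.indicator_of_mem hmem, Pi.one_apply, mul_one]
    · have hu : stUpProb X μ β K z = 0 := by unfold stUpProb; rw [if_neg hk]
      rw [hu, ENNReal.ofReal_zero, zero_mul]
  have hdown : ENNReal.ofReal (stDownProb X μ β K z) * S.indicator 1 ((levDown K z.1, z.2) : Fin (K + 1) × Ω) =
      ENNReal.ofReal (stDownProb X μ β K z) := by
    by_cases hk : 1 ≤ ((z.1 : Fin (K + 1)) : ℕ)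
    · have hmem : ((levDown K z.1, z.2) : Fin (K + 1) × Ω) ∈ S := by
        rw [hS_def, Set.mem_setOf_eq, levDown_val]; omega
      rw [Set.indicator_of_mem hmem, Pi.one_apply, mul_one]
    · have hd : stDownProb X μ β K z = 0 := by unfold stDownProb; rw [if_neg hk]
      rw [hd, ENNReal.ofReal_zero, zero_mul]
  rw [hup, hdown, ENNReal.toReal_add ENNReal.ofReal_ne_top ENNReal.ofReal_ne_top,
    ENNReal.toReal_ofReal (stUpProb_nonneg z), ENNReal.toReal_ofReal (stDownProb_nonneg z)]

variable [IsProbabilityMeasure μ]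

/-- **THE STATIONARY MOVE RATE OF THE LEVEL KERNEL IS EXACTLY `½ā_K`**:
`∫ (u + d) dπ = (1/(K+1))·Σ_{k<K} ∫ min(p_{β_k}, p_{β_{k+1}}) dμ` (the equality behind GEN-13's `st_moveRate_le`,
whose dominating ratio is `2(u+d)`). [ours] -/
theorem st_moveRate_eq (hXm : Measurable X) (hXb : ∃ C, ∀ x, |X x| ≤ C) :
    ∫ z, (stUpProb X μ β K z + stDownProb X μ β K z) ∂(stTarget X μ β K) =
      1 / (K + 1) * ∑ k ∈ range K, ∫ x, min (Real.exp (β k * X x) / mgf X μ (β k))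
        (Real.exp (β (k + 1) * X x) / mgf X μ (β (k + 1))) ∂μ := by
  have hb : ∀ z, |stUpProb X μ β K z + stDownProb X μ β K z| ≤ 1 := fun z => by
    rw [abs_of_nonneg (add_nonneg (stUpProb_nonneg z) (stDownProb_nonneg z))]
    linarith [stUpProb_le_half (X := X) (μ := μ) (β := β) z, stDownProb_le_half (X := X) (μ := μ) (β := β) z]
  rw [integral_stTarget (g := fun z => stUpProb X μ β K z + stDownProb X μ β K z)
    ((measurable_stUpProb hXm).add (measurable_stDownProb hXm)) hb]
  set ovl : ℕ → ℝ := fun k => ∫ x, min (Real.exp (β k * X x) / mgf X μ (β k))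
    (Real.exp (β (k + 1) * X x) / mgf X μ (β (k + 1))) ∂μ with hovl
  -- per level the two Metropolis ratios integrate to the overlaps (GEN-11's `stAcc_eq_overlap`)
  have hk_int : ∀ k : Fin (K + 1), ∫ x, (stUpProb X μ β K (k, x) + stDownProb X μ β K (k, x))
      ∂(μ.tilted fun x => β k * X x) =
      1 / 2 * ((if ((k : Fin (K + 1)) : ℕ) < K then ovl k else 0) +
        (if 1 ≤ ((k : Fin (K + 1)) : ℕ) then ovl ((k : ℕ) - 1) else 0)) := by
    intro k
    haveI := isProbabilityMeasure_tilted_mul (μ := μ) hXm hXb (β k)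
    have iu : Integrable (fun x => stUpProb X μ β K (k, x)) (μ.tilted fun x => β k * X x) :=
      Integrable.of_bound ((measurable_stUpProb hXm).comp measurable_prodMk_left).aestronglyMeasurable (1 / 2)
        (ae_of_all _ fun x => by
          rw [Real.norm_eq_abs, abs_of_nonneg (stUpProb_nonneg _)]; exact stUpProb_le_half _)
    have id' : Integrable (fun x => stDownProb X μ β K (k, x)) (μ.tilted fun x => β k * X x) :=
      Integrable.of_bound ((measurable_stDownProb hXm).comp measurable_prodMk_left).aestronglyMeasurable (1 / 2)
        (ae_of_all _ fun x => by
          rw [Real.norm_eq_abs, abs_of_nonneg (stDownProb_nonneg _)]; exact stDownProb_le_half _)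
    rw [integral_add iu id']
    have hu : ∫ x, stUpProb X μ β K (k, x) ∂(μ.tilted fun x => β k * X x) =
        1 / 2 * (if ((k : Fin (K + 1)) : ℕ) < K then ovl k else 0) := by
      unfold stUpProb
      dsimp only
      split_ifs with hk
      · rw [integral_const_mul, hovl, stAcc_eq_overlap hXm hXb (β k) (β (k + 1))]
      · simp
    have hd : ∫ x, stDownProb X μ β K (k, x) ∂(μ.tilted fun x => β k * X x) =
        1 / 2 * (if 1 ≤ ((k : Fin (K + 1)) : ℕ) then ovl ((k : ℕ) - 1) else 0) := by
      unfold stDownProb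
      dsimp only
      split_ifs with hk
      · rw [integral_const_mul, hovl, stAcc_eq_overlap hXm hXb (β k) (β ((k : ℕ) - 1))]
        simp only [Nat.sub_add_cancel hk]
        congr 1
        exact integral_congr_ae (ae_of_all _ fun x => min_comm _ _)
      · simp
    rw [hu, hd]; ring
  simp only [hk_int]
  rw [← Finset.mul_sum, Finset.sum_add_distrib]
  have hs1 : ∑ k : Fin (K + 1), (if ((k : Fin (K + 1)) : ℕ) < K then ovl k else 0) = ∑ k ∈ range K, ovl k := by
    rw [Fin.sum_univ_eq_sum_range (fun k => if k < K then ovl k else 0) (K + 1), Finset.sum_range_succ,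
      if_neg (lt_irrefl K), add_zero]
    exact Finset.sum_congr rfl fun k hk => if_pos (Finset.mem_range.1 hk)
  have hs2 : ∑ k : Fin (K + 1), (if 1 ≤ ((k : Fin (K + 1)) : ℕ) then ovl ((k : ℕ) - 1) else 0) =
      ∑ k ∈ range K, ovl k := by
    rw [Fin.sum_univ_eq_sum_range (fun k => if 1 ≤ k then ovl (k - 1) else 0) (K + 1), Finset.sum_range_succ']
    simp
  rw [hs1, hs2]
  ring

/-- **EXACT LEVEL LAW FOR THE LEVEL KERNEL ALONE**: `ρ_lev(1) = 1 − 3ā_K/(K(K+2))` (`K ≥ 1`). [ours] -/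
theorem stLevelKernel_level_lagOneAutocorr_eq (hXm : Measurable X) (hXb : ∃ C, ∀ x, |X x| ≤ C) (hK : 1 ≤ K) :
    (autocov (stLevelKernel hXm μ β K) (stTarget X μ β K) (fun z => (((z.1 : Fin (K + 1)) : ℕ) : ℝ)) 1 -
        ((K : ℝ) / 2) ^ 2) / (K * (K + 2) / 12) =
      1 - 3 * (2 / (K + 1) * ∑ k ∈ range K, ∫ x, min (Real.exp (β k * X x) / mgf X μ (β k))
        (Real.exp (β (k + 1) * X x) / mgf X μ (β (k + 1))) ∂μ) / (K * (K + 2)) := by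
  haveI := isProbabilityMeasure_stTarget (μ := μ) (β := β) (K := K) hXm hXb
  rw [level_lagOneAutocorr_eq (lev := fun z : Fin (K + 1) × Ω => ((z.1 : Fin (K + 1)) : ℕ))
    (invariant_stLevelKernel hXm hXb) measurable_stLevel (fun z => Nat.le_of_lt_succ z.1.isLt) hK
    (fun k hk => stTarget_real_level hXm hXb k hk) (stLevelKernel_nearestNeighbour hXm)]
  simp only [stLevelKernel_real_moves_eq hXm]
  rw [st_moveRate_eq hXm hXb]
  ring

/-- **EXACT LEVEL LAW FOR THE SAMPLER `W ∘ₖ L`** (any family `M k` of `μ_{β_k}`-invariant Markov kernels, `K ≥ 1`):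
`ρ_lev(1) = 1 − 3ā_K/(K(K+2))`. [ours] -/
theorem stScan_level_lagOneAutocorr_eq (hXm : Measurable X) (hXb : ∃ C, ∀ x, |X x| ≤ C) (hK : 1 ≤ K)
    (M : Fin (K + 1) → Kernel Ω Ω) [∀ k, IsMarkovKernel (M k)] :
    (autocov (stWithinLevel M ∘ₖ stLevelKernel hXm μ β K) (stTarget X μ β K)
          (fun z => (((z.1 : Fin (K + 1)) : ℕ) : ℝ)) 1 - ((K : ℝ) / 2) ^ 2) / (K * (K + 2) / 12) =
      1 - 3 * (2 / (K + 1) * ∑ k ∈ range K, ∫ x, min (Real.exp (β k * X x) / mgf X μ (β k))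
        (Real.exp (β (k + 1) * X x) / mgf X μ (β (k + 1))) ∂μ) / (K * (K + 2)) := by
  rw [autocov_comp_levelPreserving_after (lev := fun z : Fin (K + 1) × Ω => ((z.1 : Fin (K + 1)) : ℕ))
    (f := fun z : Fin (K + 1) × Ω => (((z.1 : Fin (K + 1)) : ℕ) : ℝ))
    (L := stLevelKernel hXm μ β K) (stWithinLevel_levelPreserving M) (measurable_from_nat.comp measurable_stLevel)
    (abs_level_le fun z : Fin (K + 1) × Ω => Nat.le_of_lt_succ z.1.isLt) (fun y y' h => by simp only [h])]
  exact stLevelKernel_level_lagOneAutocorr_eq hXm hXb hK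

/-- **EXACT LEVEL LAW FOR THE REVERSED SCAN `L ∘ₖ W`** (`M k` `μ_{β_k}`-invariant Markov, `K ≥ 1`):
`ρ_lev(1) = 1 − 3ā_K/(K(K+2))`. [ours] -/
theorem stScan_level_lagOneAutocorr_eq_before (hXm : Measurable X) (hXb : ∃ C, ∀ x, |X x| ≤ C) (hK : 1 ≤ K)
    (M : Fin (K + 1) → Kernel Ω Ω) [∀ k, IsMarkovKernel (M k)]
    (hM : ∀ k : Fin (K + 1), Kernel.Invariant (M k) (μ.tilted fun x => β k * X x)) :
    (autocov (stLevelKernel hXm μ β K ∘ₖ stWithinLevel M) (stTarget X μ β K)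
          (fun z => (((z.1 : Fin (K + 1)) : ℕ) : ℝ)) 1 - ((K : ℝ) / 2) ^ 2) / (K * (K + 2) / 12) =
      1 - 3 * (2 / (K + 1) * ∑ k ∈ range K, ∫ x, min (Real.exp (β k * X x) / mgf X μ (β k))
        (Real.exp (β (k + 1) * X x) / mgf X μ (β (k + 1))) ∂μ) / (K * (K + 2)) := by
  haveI := isProbabilityMeasure_stTarget (μ := μ) (β := β) (K := K) hXm hXb
  rw [autocov_comp_levelPreserving_before (lev := fun z : Fin (K + 1) × Ω => ((z.1 : Fin (K + 1)) : ℕ))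
    (f := fun z : Fin (K + 1) × Ω => (((z.1 : Fin (K + 1)) : ℕ) : ℝ))
    (L := stLevelKernel hXm μ β K) (invariant_stWithinLevel M hM) (stWithinLevel_levelPreserving M)
    (measurable_from_nat.comp measurable_stLevel)
    (abs_level_le fun z : Fin (K + 1) × Ω => Nat.le_of_lt_succ z.1.isLt) (fun y y' h => by simp only [h])]
  exact stLevelKernel_level_lagOneAutocorr_eq hXm hXb hK

/-- **EXACT LEVEL LAW FOR THE RANDOM-SCAN SAMPLER `t·L + (1−t)·W`** (`M k` `μ_{β_k}`-invariant Markov, `K ≥ 1`):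
`ρ_lev(1) = 1 − 3t·ā_K/(K(K+2))`. [ours] -/
theorem stMix_level_lagOneAutocorr_eq (hXm : Measurable X) (hXb : ∃ C, ∀ x, |X x| ≤ C) (hK : 1 ≤ K)
    (t : unitInterval) (M : Fin (K + 1) → Kernel Ω Ω) [∀ k, IsMarkovKernel (M k)]
    (hM : ∀ k : Fin (K + 1), Kernel.Invariant (M k) (μ.tilted fun x => β k * X x)) :
    (autocov (mixtureKernel t (stLevelKernel hXm μ β K) (stWithinLevel M)) (stTarget X μ β K)
          (fun z => (((z.1 : Fin (K + 1)) : ℕ) : ℝ)) 1 - ((K : ℝ) / 2) ^ 2) / (K * (K + 2) / 12) =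
      1 - 3 * (t : ℝ) * (2 / (K + 1) * ∑ k ∈ range K, ∫ x, min (Real.exp (β k * X x) / mgf X μ (β k))
        (Real.exp (β (k + 1) * X x) / mgf X μ (β (k + 1))) ∂μ) / (K * (K + 2)) := by
  haveI := isProbabilityMeasure_stTarget (μ := μ) (β := β) (K := K) hXm hXb
  rw [level_lagOneAutocorr_eq (lev := fun z : Fin (K + 1) × Ω => ((z.1 : Fin (K + 1)) : ℕ))
    (stMix_invariant hXm hXb t M hM) measurable_stLevel (fun z => Nat.le_of_lt_succ z.1.isLt) hK
    (fun k hk => stTarget_real_level hXm hXb k hk) (stMix_nearestNeighbour hXm t M)]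
  -- the mixture moves the level with probability `t·(u + d)`
  have hrate : ∀ z : Fin (K + 1) × Ω, (mixtureKernel t (stLevelKernel hXm μ β K) (stWithinLevel M) z).real
      {y | ((y.1 : Fin (K + 1)) : ℕ) ≠ ((z.1 : Fin (K + 1)) : ℕ)} =
      (t : ℝ) * (stUpProb X μ β K z + stDownProb X μ β K z) := by
    intro z
    rw [mixtureKernel_real, stLevelKernel_real_moves_eq hXm, measureReal_def, stWithinLevel_levelPreserving M z,
      ENNReal.toReal_zero, mul_zero, add_zero]
  simp only [hrate]
  rw [integral_const_mul, st_moveRate_eq hXm hXb]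
  ring

end Sampler

/-! ## §3 The two-sided ladder law -/

section Ladder

variable {Ω : Type*} [MeasurableSpace Ω] {X : Ω → ℝ} {μ : Measure Ω} [IsProbabilityMeasure μ] {K : ℕ}

/-- **THE TWO-SIDED LADDER LAW FOR THE SAMPLER.**  Uniform ladder `β_k = a + kΔ`, `Δ = (b−a)/K`, `a < b`,
`K ≥ 1`, variance floor and ceiling `m ≤ Var_{μ_u}(X) ≤ M` on `[a, b]`, `M k` any `μ_{β_k}`-invariant Markov
kernels.  Then the sampler `W ∘ₖ L` satisfies
`6·e^{−(Δ√M + MΔ²)}/((K+1)(K+2)) ≤ 1 − ρ_lev(1) ≤ 6·e^{−mΔ²/8}/((K+1)(K+2))`. [ours] -/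
theorem stScan_one_sub_lagOneAutocorr_twoSided (hXm : Measurable X) (hXb : ∃ C, ∀ x, |X x| ≤ C) {a b m M : ℝ}
    (hab : a < b) (hm : ∀ u ∈ Icc a b, m ≤ variance X (μ.tilted fun x => u * X x))
    (hM : ∀ u ∈ Icc a b, variance X (μ.tilted fun x => u * X x) ≤ M) (hK : 1 ≤ K)
    (Mk : Fin (K + 1) → Kernel Ω Ω) [∀ k, IsMarkovKernel (Mk k)] :
    6 * Real.exp (-((b - a) / K * Real.sqrt M + M * ((b - a) / K) ^ 2)) / ((K + 1) * (K + 2)) ≤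
      1 - (autocov (stWithinLevel Mk ∘ₖ stLevelKernel hXm μ (fun k => a + k * ((b - a) / K)) K)
          (stTarget X μ (fun k => a + k * ((b - a) / K)) K)
          (fun z => (((z.1 : Fin (K + 1)) : ℕ) : ℝ)) 1 - ((K : ℝ) / 2) ^ 2) / (K * (K + 2) / 12) ∧
    1 - (autocov (stWithinLevel Mk ∘ₖ stLevelKernel hXm μ (fun k => a + k * ((b - a) / K)) K)
          (stTarget X μ (fun k => a + k * ((b - a) / K)) K)
          (fun z => (((z.1 : Fin (K + 1)) : ℕ) : ℝ)) 1 - ((K : ℝ) / 2) ^ 2) / (K * (K + 2) / 12) ≤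
      6 * Real.exp (-(m * (b - a) ^ 2 / (8 * K ^ 2))) / ((K + 1) * (K + 2)) := by
  rw [stScan_level_lagOneAutocorr_eq (β := fun k => a + k * ((b - a) / K)) hXm hXb hK Mk]
  have hKr : (1 : ℝ) ≤ K := by exact_mod_cast hK
  have hK0 : (0 : ℝ) < K := by linarith
  have hδ : 0 ≤ (b - a) / K := div_nonneg (sub_nonneg.2 hab.le) hK0.le
  -- the sum of adjacent overlaps, bounded on both sides rung by rung
  set S : ℝ := ∑ k ∈ range K, ∫ x, min (Real.exp ((a + k * ((b - a) / K)) * X x) / mgf X μ (a + k * ((b - a) / K)))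
    (Real.exp ((a + (k + 1 : ℕ) * ((b - a) / K)) * X x) / mgf X μ (a + (k + 1 : ℕ) * ((b - a) / K))) ∂μ with hS_def
  have hup : 2 / (K + 1) * S ≤ 2 * K / (K + 1) * Real.exp (-(m * (b - a) ^ 2 / (8 * K ^ 2))) :=
    st_moveRate_le_ladder (μ := μ) hXm hXb hab.le hK hm
  have hlow : (K : ℝ) * Real.exp (-((b - a) / K * Real.sqrt M + M * ((b - a) / K) ^ 2)) ≤ S := by
    have hstep : ∀ k ∈ range K, Real.exp (-((b - a) / K * Real.sqrt M + M * ((b - a) / K) ^ 2)) ≤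
        ∫ x, min (Real.exp ((a + k * ((b - a) / K)) * X x) / mgf X μ (a + k * ((b - a) / K)))
          (Real.exp ((a + (k + 1 : ℕ) * ((b - a) / K)) * X x) / mgf X μ (a + (k + 1 : ℕ) * ((b - a) / K))) ∂μ := by
      intro k hk
      have hkK : (k : ℝ) + 1 ≤ K := by exact_mod_cast Finset.mem_range.1 hk
      have hs : a ≤ a + k * ((b - a) / K) := le_add_of_nonneg_right (mul_nonneg (Nat.cast_nonneg _) hδ)
      have hst : a + k * ((b - a) / K) ≤ a + (k + 1 : ℕ) * ((b - a) / K) := by push_cast; nlinarith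
      have ht : a + (k + 1 : ℕ) * ((b - a) / K) ≤ b := by
        push_cast
        have : ((k : ℝ) + 1) * ((b - a) / K) ≤ K * ((b - a) / K) := mul_le_mul_of_nonneg_right hkK hδ
        rw [mul_div_cancel₀ _ hK0.ne'] at this
        linarith
      have h := overlap_ge_exp_neg_ceiling hXm hXb hst fun u hu => hM u ⟨hs.trans hu.1, hu.2.trans ht⟩
      have e : a + (k + 1 : ℕ) * ((b - a) / K) - (a + k * ((b - a) / K)) = (b - a) / K := by push_cast; ring
      rw [e] at h
      exact h
    calc (K : ℝ) * Real.exp (-((b - a) / K * Real.sqrt M + M * ((b - a) / K) ^ 2))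
        = ∑ _k ∈ range K, Real.exp (-((b - a) / K * Real.sqrt M + M * ((b - a) / K) ^ 2)) := by
          rw [Finset.sum_const, Finset.card_range, nsmul_eq_mul]
      _ ≤ S := Finset.sum_le_sum hstep
  have hK1 : (0 : ℝ) < K + 1 := by linarith
  have hK2 : (0 : ℝ) < (K + 1) * (K + 2) := by positivity
  have hKK : (0 : ℝ) < K * (K + 2) := by positivity
  constructor
  · -- lower bound: `6e^{…}/((K+1)(K+2)) ≤ 3·(2/(K+1))·S/(K(K+2))`
    have e : 1 - (1 - 3 * (2 / (K + 1) * S) / (K * (K + 2))) = 6 * S / ((K + 1) * (K * (K + 2))) := by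
      field_simp
      ring
    rw [e, div_le_div_iff₀ hK2 (by positivity)]
    have h1 : 6 * Real.exp (-((b - a) / K * Real.sqrt M + M * ((b - a) / K) ^ 2)) * ((K + 1) * (K * (K + 2))) =
        (6 * (K * Real.exp (-((b - a) / K * Real.sqrt M + M * ((b - a) / K) ^ 2)))) * ((K + 1) * (K + 2)) := by
      ring
    rw [h1]
    exact mul_le_mul_of_nonneg_right (by linarith) hK2.le
  · have e : 1 - (1 - 3 * (2 / (K + 1) * S) / (K * (K + 2))) = 3 * (2 / (K + 1) * S) / (K * (K + 2)) := by ring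
    rw [e]
    calc 3 * (2 / (K + 1) * S) / (K * (K + 2))
        ≤ 3 * (2 * K / (K + 1) * Real.exp (-(m * (b - a) ^ 2 / (8 * K ^ 2)))) / (K * (K + 2)) := by
          gcongr
      _ = 6 * Real.exp (-(m * (b - a) ^ 2 / (8 * K ^ 2))) / ((K + 1) * (K + 2)) := by
          field_simp
          ring

end Ladder

end Summit.Ventures.LatticeQCDFlow.Scaling

end
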